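import Literature.Analysis.FunctionSpaces.EquicontinuousSubsequence
import Literature.Analysis.FunctionSpaces.LpJointMeasurable
import Literature.Analysis.FluidPDE.DuchonRobertInviscidLimit
import Literature.Analysis.FluidPDE.NSStrongSolutions2D

/-!
# Sobolev-condensate no-go for `TwoAndHalfD.TwohalfdThesis` (stmt-AnomalousDissipation-0206), stub SC-CMP:
# compactness of bounded-enstrophy, `L²`-equi-Lipschitz comparison flows

Crux `TwohalfdThesis` (= X), line `Sketch`, lead c7, section N of the skeleton (Sobolev condensates); this
file replaces the Arzelà–Ascoli step RC-AA of the sibling regular-condensate theorem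
(`Theorems/TwoAndHalfDTwohalfdNegRegularCondensateArzelaAscoli.lean`, uniformly LIPSCHITZ flows) for
comparison flows `W_k : ℝ → T² → ℝ²` that are only continuous, bounded by `B`, weakly divergence free,
of spectral enstrophy `‖∇W_k(t)‖₂² ≤ G` and `L²`-Lipschitz in time, `‖W_k(t) − W_k(s)‖_{L²} ≤ B|t − s|`.
GIVEN the compactness of the Rellich set `K = {w ∈ L²(T²; ℝ²) | ‖w‖ ≤ B ∧ ‖∇w‖₂² ≤ G}` (stub SC-RL), a
subsequence converges in `L²((0,S) × T²)` to a jointly measurable `W'` whose slices are, for a.e.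
`t ∈ (0,S)`, in `L²` with norm `≤ B`, enstrophy `≤ G` and weakly divergence free.

Proof.  (1) The `L²` classes `F_k(t) = [W_k(t)] ∈ L²(T²; ℝ²)` lie in `K` (`‖W_k(t)‖_{L²} ≤ B` on the
probability space `T²`; the enstrophy only sees the a.e. class, `eGradNormSq_congr_ae`) and the paths
`F_k : ℝ → L²` are `B`-Lipschitz, hence equicontinuous; the tree's sequential Arzelà–Ascoli theorem
`exists_subseq_tendstoUniformlyOn_of_equicontinuous` (Rudin, *Principles*, Thm. 7.25) on the totally
bounded `[0, S]` with values in the compact `K` gives `φ` and a uniform limit `g : [0,S] → K`, continuous.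
(2) The tree's selection theorem `exists_measurable_uncurry_of_continuousOn_Lp` (Rudin, *Real and Complex
Analysis*, Thm. 3.11) gives an honest `W' : ℝ → T² → ℝ²`, jointly measurable, with `W'(t) = g(t)` a.e.
for every `t ∈ [0, S]`; the slice bounds are those of `g(t) ∈ K`.  (3) `∫⁻ₓ ‖W_{φ n}(t) − W'(t)‖ₑ² =
dist(F_{φ n}(t), g(t))²` is uniformly small on `[0, S]`, so `∫₀^S ∫⁻ₓ ‖W_{φ n} − W'‖ₑ² → 0` (Tonelli for
the product form), and weak incompressibility of a.e. slice of `W'` is the tree's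
`Torus.ae_isWeaklyDivFree_of_tendsto_lintegral` (Temam, Ch. I §1.4: `H` is closed in `L²`).

* `stub_scCompactness` — the registered stub (last declaration).  Supports stmt-AnomalousDissipation-0206.

## Mathlib / Literature search

`lean search 'exists_subseq_tendstoUniformlyOn'`, `'exists_measurable_uncurry'`, `'ae_isWeaklyDivFree'`,
`'eLpNorm_two_sq|lintegral_enorm_sq_eq'`: the three tree theorems above are used by name; Mathlib has
no lemma `eLpNorm f 2 μ ^ 2 = ∫⁻ ‖f‖ₑ²` (the tree has copies, e.g.
`EnstrophySplitting.lintegral_enorm_sq_eq_eLpNorm_two_sq`, none in this file's import closure), so a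
private two-line helper `eLpNorm_two_sq_eq_lintegral_enorm_sq` is proved from Mathlib's
`lintegral_rpow_enorm_eq_rpow_eLpNorm'`.

## References

* W. Rudin, *Principles of Mathematical Analysis* (3rd ed.), Thm. 7.25 (Arzelà–Ascoli). [`Rudin1976`]
* W. Rudin, *Real and Complex Analysis* (3rd ed.), Thm. 3.11 (Riesz–Fischer, a.e. convergent
  subsequences). [`Rudin1987`]
* R. Temam, *Navier–Stokes Equations*, Ch. I §1.4 (the closed subspace `H ⊂ L²` of weakly
  divergence-free fields).
-/

noncomputable section

namespace Summit.AnomalousDissipation.AnomalousDissipation.Theorems.TwohalfdThesis.SobolevCondensate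

open MeasureTheory Filter Topology Set Function
open scoped ENNReal NNReal InnerProductSpace
open Literature.Analysis.FunctionSpaces Literature.Analysis.FluidPDE

set_option linter.dupNamespace false -- the registry path `AnomalousDissipation.AnomalousDissipation`

/-- `‖f‖²_{L²} = ∫⁻ ‖f‖ₑ²` (the `p = 2` case of `lintegral_rpow_enorm_eq_rpow_eLpNorm'`, with natural-number
squares). [folklore] -/
private theorem eLpNorm_two_sq_eq_lintegral_enorm_sq {α F : Type*} [MeasurableSpace α] {μ : Measure α}
    [NormedAddCommGroup F] (f : α → F) : eLpNorm f 2 μ ^ 2 = ∫⁻ x, ‖f x‖ₑ ^ 2 ∂μ := by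
  have h := lintegral_rpow_enorm_eq_rpow_eLpNorm' (μ := μ) (f := f) (q := 2) two_pos
  simp only [ENNReal.rpow_two] at h
  rw [h, eLpNorm_eq_eLpNorm' two_ne_zero ENNReal.ofNat_ne_top, ENNReal.toReal_ofNat]

/-- **SC-CMP `stub_scCompactness` — compactness of bounded-enstrophy, `L²`-equi-Lipschitz comparison
flows (registered stub).**  Continuous comparison flows `W_k` on `ℝ × T²` with `‖W_k‖ ≤ B`, weakly
divergence free at every time, `‖∇W_k(t)‖²_{L²} ≤ G` and `‖W_k(t) − W_k(s)‖_{L²} ≤ B|t−s|`, GIVEN the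
compactness of the Rellich set `{‖w‖ ≤ B, ‖∇w‖₂² ≤ G} ⊂ L²(T²; ℝ²)`, have a subsequence converging in
`L²((0,S) × T²)` to a jointly measurable `W'` whose slices are, for a.e. `t ∈ (0,S)`, in `L²` with norm
`≤ B`, enstrophy `≤ G` and weakly divergence free.  Arzelà–Ascoli in `C([0,S]; L²(T²; ℝ²))`
(`exists_subseq_tendstoUniformlyOn_of_equicontinuous`, Rudin *Principles* Thm. 7.25) with values in the
compact Rellich set; a jointly measurable representative of the continuous `L²`-valued limit path
(`exists_measurable_uncurry_of_continuousOn_Lp`, Rudin *Real and Complex Analysis* Thm. 3.11); the slice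
bounds are read off the limit classes (`eGradNormSq_congr_ae`), the `L²ₜₓ` convergence is the uniform one
integrated over `(0,S)` (Tonelli), and weak incompressibility of a.e. slice is
`Torus.ae_isWeaklyDivFree_of_tendsto_lintegral` (Temam, Ch. I §1.4). [folklore] -/
theorem stub_scCompactness :
    ∀ (B S : ℝ) (G : ℝ≥0) (W : ℕ → ℝ → UnitAddTorus (Fin 2) → EuclideanSpace ℝ (Fin 2)), 0 < S →
      IsCompact {w : Lp (EuclideanSpace ℝ (Fin 2)) 2 (volume : Measure (UnitAddTorus (Fin 2))) |
        ‖w‖ ≤ B ∧ Torus.eGradNormSq (w : UnitAddTorus (Fin 2) → EuclideanSpace ℝ (Fin 2)) ≤ G} →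
      (∀ k, Continuous (Function.uncurry (W k))) → (∀ k t x, ‖W k t x‖ ≤ B) →
      (∀ k t, Torus.IsWeaklyDivFree (W k t)) →
      (∀ k t, Torus.eGradNormSq (W k t) ≤ G) →
      (∀ k s t, eLpNorm (W k t - W k s) 2 volume ≤ ENNReal.ofReal (B * |t - s|)) →
      ∃ (φ : ℕ → ℕ) (W' : ℝ → UnitAddTorus (Fin 2) → EuclideanSpace ℝ (Fin 2)), StrictMono φ ∧
        AEStronglyMeasurable (Function.uncurry W')
          (((volume : Measure ℝ).restrict (Set.Ioo 0 S)).prod volume) ∧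
        (∀ᵐ t ∂(volume.restrict (Set.Ioo 0 S)), MemLp (W' t) 2 volume ∧
          eLpNorm (W' t) 2 volume ≤ ENNReal.ofReal B ∧ Torus.eGradNormSq (W' t) ≤ G ∧
          Torus.IsWeaklyDivFree (W' t)) ∧
        Tendsto (fun n => ∫⁻ p, ‖W (φ n) p.1 p.2 - W' p.1 p.2‖ₑ ^ 2
          ∂(((volume : Measure ℝ).restrict (Set.Ioo 0 S)).prod volume)) atTop (𝓝 0) := by
  intro B S G W hS hK hcont hbd hdiv hG hlip
  have hB : 0 ≤ B := (norm_nonneg _).trans (hbd 0 0 0)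
  /- (1) the slices as elements of the compact Rellich set, `B`-Lipschitz in time -/
  have hWc : ∀ k t, Continuous (W k t) := fun k t => (hcont k).uncurry_left t
  have hmem : ∀ k t, MemLp (W k t) 2 (volume : Measure (UnitAddTorus (Fin 2))) := fun k t =>
    MemLp.of_bound (hWc k t).aestronglyMeasurable B (Eventually.of_forall (hbd k t))
  have heLp : ∀ k t, eLpNorm (W k t) 2 (volume : Measure (UnitAddTorus (Fin 2))) ≤
      ENNReal.ofReal B := fun k t => by
    simpa only [measure_univ, ENNReal.one_rpow, one_mul] using
      eLpNorm_le_of_ae_bound (p := (2 : ℝ≥0∞)) (μ := (volume : Measure (UnitAddTorus (Fin 2))))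
        (Eventually.of_forall (hbd k t))
  obtain ⟨F, hF⟩ : ∃ F : ℕ → ℝ → Lp (EuclideanSpace ℝ (Fin 2)) 2
      (volume : Measure (UnitAddTorus (Fin 2))), ∀ k t, F k t = (hmem k t).toLp (W k t) :=
    ⟨_, fun _ _ => rfl⟩
  have hFae : ∀ k t, (F k t : UnitAddTorus (Fin 2) → EuclideanSpace ℝ (Fin 2)) =ᵐ[volume] W k t :=
    fun k t => by
      rw [hF]
      exact MemLp.coeFn_toLp _
  have hFK : ∀ k t, ‖F k t‖ ≤ B ∧
      Torus.eGradNormSq (F k t : UnitAddTorus (Fin 2) → EuclideanSpace ℝ (Fin 2)) ≤ G := fun k t =>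
    ⟨by rw [hF, Lp.norm_toLp]; exact ENNReal.toReal_le_of_le_ofReal hB (heLp k t),
      by rw [eGradNormSq_congr_ae (hFae k t)]; exact hG k t⟩
  have hFdist : ∀ k t s, dist (F k t) (F k s) ≤ B * |t - s| := fun k t s => by
    rw [Lp.dist_def]
    refine ENNReal.toReal_le_of_le_ofReal (by positivity) ?_
    calc eLpNorm ((F k t : UnitAddTorus (Fin 2) → EuclideanSpace ℝ (Fin 2)) -
          (F k s : UnitAddTorus (Fin 2) → EuclideanSpace ℝ (Fin 2))) 2 volume
        = eLpNorm (W k t - W k s) 2 volume := eLpNorm_congr_ae ((hFae k t).sub (hFae k s))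
      _ ≤ ENNReal.ofReal (B * |t - s|) := hlip k s t
  have hFcont : ∀ k, Continuous (F k) := fun k => by
    refine (LipschitzWith.of_dist_le' (K := B) fun t s => ?_).continuous
    rw [Real.dist_eq t s]
    exact hFdist k t s
  /- (2) Arzelà–Ascoli in `C([0,S]; L²)` -/
  obtain ⟨φ, hφ, g, hg⟩ := exists_subseq_tendstoUniformlyOn_of_equicontinuous
    (isCompact_Icc : IsCompact (Icc (0 : ℝ) S)).totallyBounded hK F (fun i t _ => hFK i t)
    (by
      intro ε hε
      refine ⟨ε / (B + 1), by positivity, fun i t _ s _ hts => (hFdist i t s).trans ?_⟩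
      rw [Real.dist_eq] at hts
      calc B * |t - s| ≤ B * (ε / (B + 1)) := mul_le_mul_of_nonneg_left hts.le hB
        _ ≤ ε := by
            rw [mul_div_assoc', div_le_iff₀ (by positivity)]
            nlinarith)
  have hgK : ∀ t ∈ Icc (0 : ℝ) S, ‖g t‖ ≤ B ∧
      Torus.eGradNormSq (g t : UnitAddTorus (Fin 2) → EuclideanSpace ℝ (Fin 2)) ≤ G := fun t ht =>
    hK.isClosed.mem_of_tendsto (hg.tendsto_at ht) (Eventually.of_forall fun n => hFK (φ n) t)
  have hgc : ContinuousOn g (Icc 0 S) :=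
    hg.continuousOn (Eventually.of_forall fun n => (hFcont (φ n)).continuousOn).frequently
  /- (3) a jointly measurable representative of the limit path -/
  obtain ⟨W', hW'm, hW'g⟩ := exists_measurable_uncurry_of_continuousOn_Lp g hgc
  have hslice : ∀ n, ∀ t ∈ Icc (0 : ℝ) S,
      ∫⁻ x, ‖W (φ n) t x - W' t x‖ₑ ^ 2 = edist (F (φ n) t) (g t) ^ 2 := by
    intro n t ht
    rw [Lp.edist_def, eLpNorm_two_sq_eq_lintegral_enorm_sq]
    refine lintegral_congr_ae ?_
    filter_upwards [hFae (φ n) t, hW'g t ht] with x hx hx'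
    rw [Pi.sub_apply, hx, hx']
  /- (4) `L²ₜₓ` convergence from the uniform convergence on `[0, S]` -/
  have hconv : Tendsto (fun n => ∫⁻ t in Ioo 0 S, ∫⁻ x, ‖W (φ n) t x - W' t x‖ₑ ^ 2)
      atTop (𝓝 0) := by
    rw [ENNReal.tendsto_nhds_zero]
    intro ε hε
    rcases eq_or_ne ε ⊤ with rfl | hεtop
    · exact Eventually.of_forall fun n => le_top
    have hε' : 0 < ε.toReal := ENNReal.toReal_pos hε.ne' hεtop
    obtain ⟨η, hη, hηS⟩ : ∃ η : ℝ, 0 < η ∧ ENNReal.ofReal η ^ 2 * ENNReal.ofReal S = ε := by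
      refine ⟨Real.sqrt (ε.toReal / S), Real.sqrt_pos.2 (div_pos hε' hS), ?_⟩
      rw [← ENNReal.ofReal_pow (Real.sqrt_nonneg _), ← ENNReal.ofReal_mul (sq_nonneg _),
        Real.sq_sqrt (div_pos hε' hS).le, div_mul_cancel₀ _ hS.ne', ENNReal.ofReal_toReal hεtop]
    filter_upwards [Metric.tendstoUniformlyOn_iff.1 hg η hη] with n hn
    calc ∫⁻ t in Ioo 0 S, ∫⁻ x, ‖W (φ n) t x - W' t x‖ₑ ^ 2
        ≤ ∫⁻ t in Ioo (0 : ℝ) S, ENNReal.ofReal η ^ 2 := by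
          refine setLIntegral_mono' measurableSet_Ioo fun t ht => ?_
          rw [hslice n t (Ioo_subset_Icc_self ht), edist_comm, edist_dist]
          gcongr
          exact (hn t (Ioo_subset_Icc_self ht)).le
      _ = ENNReal.ofReal η ^ 2 * volume (Ioo (0 : ℝ) S) := setLIntegral_const _ _
      _ = ε := by rw [Real.volume_Ioo, sub_zero, hηS]
  have hmeas_sub : ∀ n, AEStronglyMeasurable (uncurry fun t x => W (φ n) t x - W' t x)
      (((volume : Measure ℝ).restrict (Ioo 0 S)).prod volume) := fun n =>
    (hcont (φ n)).aestronglyMeasurable.sub hW'm.aestronglyMeasurable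
  /- (5) the slice properties -/
  have hu2 : ∫⁻ t in Ioo 0 S, ∫⁻ x, ‖W' t x‖ₑ ^ 2 < ⊤ := by
    calc ∫⁻ t in Ioo 0 S, ∫⁻ x, ‖W' t x‖ₑ ^ 2 ≤ ∫⁻ t in Ioo (0 : ℝ) S, ENNReal.ofReal B ^ 2 := by
          refine setLIntegral_mono' measurableSet_Ioo fun t ht => ?_
          rw [← eLpNorm_two_sq_eq_lintegral_enorm_sq (W' t),
            eLpNorm_congr_ae (hW'g t (Ioo_subset_Icc_self ht)), ← Lp.enorm_def, ← ofReal_norm]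
          gcongr
          exact (hgK t (Ioo_subset_Icc_self ht)).1
      _ = ENNReal.ofReal B ^ 2 * volume (Ioo (0 : ℝ) S) := setLIntegral_const _ _
      _ < ⊤ := ENNReal.mul_lt_top (ENNReal.pow_lt_top ENNReal.ofReal_lt_top) measure_Ioo_lt_top
  have hdivae : ∀ᵐ t ∂(volume.restrict (Ioo 0 S)), Torus.IsWeaklyDivFree (W' t) :=
    Torus.ae_isWeaklyDivFree_of_tendsto_lintegral (useq := fun m => W (φ m)) (u := W')
      (fun m => (hcont (φ m)).aestronglyMeasurable)
      (fun m => Eventually.of_forall fun t => hdiv (φ m) t) hW'm.aestronglyMeasurable hu2 hconv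
  refine ⟨φ, W', hφ, hW'm.aestronglyMeasurable, ?_, ?_⟩
  · filter_upwards [ae_restrict_mem measurableSet_Ioo, hdivae] with t ht hdt
    have ht' : t ∈ Icc (0 : ℝ) S := Ioo_subset_Icc_self ht
    have hae := hW'g t ht'
    refine ⟨(Lp.memLp (g t)).ae_eq hae.symm, ?_, ?_, hdt⟩
    · rw [eLpNorm_congr_ae hae, ← Lp.enorm_def, ← ofReal_norm]
      exact ENNReal.ofReal_le_ofReal (hgK t ht').1
    · rw [eGradNormSq_congr_ae hae]
      exact (hgK t ht').2
  · refine hconv.congr fun n => ?_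
    exact Torus.lintegral_Ioo_lintegral_eq_lintegral_prod ((hmeas_sub n).enorm.pow_const _)

end Summit.AnomalousDissipation.AnomalousDissipation.Theorems.TwohalfdThesis.SobolevCondensate

end
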